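import Literature.MathematicalPhysics.QuantumLattice.InfVolFermionStateBoxState
import Literature.MathematicalPhysics.QuantumLattice.DWaveOrderParameterInfiniteVolume
import Literature.MathematicalPhysics.QuantumLattice.ErgodicStatesODLROProofs
import Literature.MathematicalPhysics.QuantumLattice.LocalPairOn
import HarnessLib

/-!
# The box state on pair fields: the torus pair-field fluctuation `φ_L(Δ⋆Δ)` IS the box pair-LRO sum of
# the infinite-volume state up to `O(L³)` wrapped pairs; the sourced `t–t'` torus Hamiltonian under the
# box state of a translation-invariant ground state

Topic `Literature/MathematicalPhysics/QuantumLattice` (namespace = path; family `hubbard`). Sequel of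
`InfVolFermionStateBoxState.lean` (the box state `φ_L = ω.boxState L` of an infinite-volume fermion state on
the torus of side `L`): step (ε) of the transplant lens's proof chain (Hubbard cuprate cell `hubbard-cq`,
DICTIONARY §12) for the pair-LRO ceiling `TIGroundStatePairLROCeiling` of translation-invariant sourced ground
states. In Bogoliubov Jr.'s zero-temperature approximating-Hamiltonian bound on the torus
(`ApproximatingHamiltonianGroundEnergy.lean`, attractive channel `U = √g·Δ_d`) the trial state is `φ_L`; the
two model-specific inputs it needs are typed here:

* §1 a priori norms: `‖P_x‖ ≤ K_{S,g} = 2Σ_{e∈S}|g e/√2|` for the torus (`norm_localPairOn_le`) and the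
  infinite-lattice (`norm_localPairAt_le`) local pairs, hence (with hubbard-cq-lit-1's `norm_corr_le`)
  `‖ω(P_x⋆ P_y)‖ ≤ K²` (`InfVolFermionState.norm_pairCorr_le`).
* §2 INTERIOR PAIRS: if the pair regions of `x, y ∈ ℤ²` lie inside `[0,L)²` then
  `φ_L(P̃_{x mod L}⋆ P̃_{y mod L}) = ω(P_x⋆ P_y)` (`boxState_localPairOn_conjTranspose_mul_localPairOn`).
* §3 THE TWO-POINT BOOKKEEPING (every state `ω`, every step set `S ⊆ [−R,R]²`, `2R ≤ L`):
  `|Re φ_L(Δ̃⋆Δ̃) − Re Σ_{x,y∈[0,L)²} ω(P_x⋆P_y)| ≤ 4K² (L² − (L−2R)²) L²`, `Δ̃ = pairFieldOn S g L = Σ_x̄ P̃_x̄`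
  (`abs_re_boxState_pairFieldOn_sub_re_sum_pairCorr_le`): only the `≤ 2(L² − (L−2R)²)L²` pairs with a
  wrapped end differ, each by at most `2K²`. For the `d`-wave pair field (`R = 1`):
  `|L⁻⁴ Re φ_L(Δ_d⋆Δ_d) − boxLRO_L(ω)| ≤ 16K_d²/L` in the cell's box normal form
  (`abs_re_boxState_pairField_div_sub_re_boxAverage_dWavePairCorr_le`).
* §4 THE SOURCED TORUS UNDER THE BOX STATE: for translation-invariant `ω` and `L ≥ 3`,
  `|Re φ_L(A_L(t',U,μ,h)) − L²·e_{Ψ_h}(ω)| ≤ 4L·C_src` with `A_L = dWaveSourceTorusTT' L t' U μ h`,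
  `e_{Ψ_h}(ω)` the mean energy for `Ψ_h = hubbardTTPrimeSourcedInteraction 1 t' U μ dWaveFormFactor h` and
  `C_src = −E₀(−E^src) − E₀(E^src)` (`abs_re_boxState_dWaveSourceTorusTT'_sub_sq_mul_meanEnergy_le`); for a
  translation-invariant GROUND STATE `e_{Ψ_h}(ω) = E(h) = dWaveSourceEnergyDensityTT' t' U μ h`. Assembled
  TRIAL-STATE INEQUALITY for the model Hamiltonian `A_L − c•Δ_d⋆Δ_d` (`c ≥ 0`):
  `E₀(A_L − c•Δ_d⋆Δ_d) ≤ L²E(h) + 4C_src·L − c·(L⁴·boxLRO_L(ω) − 16K_d²·L³)`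
  (`IsMeanEnergyMinimiser.groundEnergy_dWaveSourceTorusTT'_sub_smul_le`) — the exact input of step (ζ);
  §5 restates it in the linear `∃ c₁ c₂ L₁, ∀ L ≥ L₁, ∀ g ≥ 0` shape
  `E₀(A_L − (g/L²)•Δ_d⋆Δ_d) ≤ L²E(h) + c₁L − gL²·boxLRO_L(ω) + g c₂ L` consumed by the `(ζ)` assembler
  (`IsMeanEnergyMinimiser.exists_groundEnergy_dWaveSourceTorusTT'_sub_smul_le_linear`, and a form with `c₂, L₁`
  uniform in `h, ω`).

Everything is PROVED; no definition, no named fact, zero compute. HONEST SCOPE: bookkeeping identities and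
a priori bounds; nothing here bears on `d`-wave order.

## References
* O. Bratteli, D. W. Robinson, *Operator Algebras and Quantum Statistical Mechanics 2* (1997), §6.2.2
  (states restricted to periodic boxes; surface terms). [cite: BratteliRobinsonII1997, §6.2.2]
* N. N. Bogolubov Jr., Physica 32 (1966) 933, Thm. 1. [cite: Bogolubov1966, Theorem 1]
* D. J. Scalapino, Phys. Rep. 250 (1995) 329, §2 eq. (2.2)–(2.4) (pair fields, pair correlations).
  [cite: Scalapino1995, §2]
* G. L. Sewell, *Quantum Theory of Collective Phenomena* (1986) / J. Math. Phys. 11 (1970), §4 (ODLRO of states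
  of the quasi-local algebra). [cite: Sewell1970, §4]
* T. Koma, H. Tasaki, J. Stat. Phys. 76 (1994) 745, §1. [cite: KomaTasaki1994, §1]
-/

noncomputable section

namespace Literature.MathematicalPhysics.QuantumLattice

open Matrix Finset HubbardWave0 Literature.Probability.LatticeModels _root_.Filter
open scoped _root_.Topology ComplexOrder BigOperators MatrixOrder Matrix.Norms.L2Operator

/-! ### §1 A priori norms of local pairs and pair correlations -/

section Norms

/-- A singlet bond word has norm `≤ 2`: `‖c_a c_b − c_c c_d‖ ≤ 2` (`‖c‖ ≤ 1`). [cite: Scalapino1995, §2] -/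
theorem norm_annihilation_mul_sub_mul_le_two {ι : Type*} [LinearOrder ι] [Fintype ι] (a b c e : ι) :
    ‖(annihilation a : Matrix (Finset ι) (Finset ι) ℂ) * annihilation b - annihilation c * annihilation e‖ ≤ 2 := by
  have h1 : ∀ i j : ι, ‖(annihilation i : Matrix (Finset ι) (Finset ι) ℂ) * annihilation j‖ ≤ 1 := fun i j =>
    calc _ ≤ ‖(annihilation i : Matrix (Finset ι) (Finset ι) ℂ)‖ * ‖(annihilation j : Matrix (Finset ι) (Finset ι) ℂ)‖ :=
          norm_mul_le _ _
      _ ≤ 1 * 1 := mul_le_mul (norm_annihilation_le_one i) (norm_annihilation_le_one j) (norm_nonneg _) zero_le_one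
      _ = 1 := one_mul 1
  calc _ ≤ ‖(annihilation a : Matrix (Finset ι) (Finset ι) ℂ) * annihilation b‖ +
        ‖(annihilation c : Matrix (Finset ι) (Finset ι) ℂ) * annihilation e‖ := norm_sub_le _ _
    _ ≤ 1 + 1 := add_le_add (h1 a b) (h1 c e)
    _ = 2 := by norm_num

/-- **`‖P̃_x‖ ≤ 2 Σ_{e∈S} |g e/√2|`** for the torus local pair on an arbitrary step set. [cite: Scalapino1995, §2] -/
theorem norm_localPairOn_le (S : Finset (Site 2)) (g : Site 2 → ℝ) (L : ℕ) [NeZero L] (x : TorusSite 2 L) :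
    ‖localPairOn S g L x‖ ≤ 2 * ∑ e ∈ S, |g e / Real.sqrt 2| := by
  unfold localPairOn
  rw [Finset.mul_sum]
  refine (norm_sum_le _ _).trans (Finset.sum_le_sum fun e _ => ?_)
  rw [norm_smul, Complex.norm_real, Real.norm_eq_abs, mul_comm]
  exact mul_le_mul_of_nonneg_right (norm_annihilation_mul_sub_mul_le_two _ _ _ _) (abs_nonneg _)

/-- **`‖P_x‖ ≤ 2 Σ_{e∈S} |g e/√2|`** for the local pair of the INFINITE lattice. [cite: Scalapino1995, §2] -/
theorem norm_localPairAt_le (S : Finset (Site 2)) (g : Site 2 → ℝ) (x : Site 2) :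
    ‖localPairAt S g x‖ ≤ 2 * ∑ e ∈ S, |g e / Real.sqrt 2| := by
  unfold localPairAt
  rw [← Finset.sum_attach S, Finset.mul_sum]
  refine (norm_sum_le _ _).trans (Finset.sum_le_sum fun e _ => ?_)
  rw [norm_smul, Complex.norm_real, Real.norm_eq_abs, mul_comm]
  exact mul_le_mul_of_nonneg_right (norm_annihilation_mul_sub_mul_le_two _ _ _ _) (abs_nonneg _)

/-- The constant `K_{S,g} = 2 Σ_{e∈S} |g e/√2|` is non-negative. [cite: Scalapino1995, §2] -/
theorem two_mul_sum_abs_div_sqrt_two_nonneg (S : Finset (Site 2)) (g : Site 2 → ℝ) :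
    0 ≤ 2 * ∑ e ∈ S, |g e / Real.sqrt 2| :=
  mul_nonneg zero_le_two (Finset.sum_nonneg fun _ _ => abs_nonneg _)

/-- **`‖ω(P_x⋆ P_y)‖ ≤ K²`**: the pair two-point function of ANY infinite-volume state is bounded by the
squared norm constant (contractivity of `ω` and of `Γ`). [cite: Sewell1970, §4] -/
theorem InfVolFermionState.norm_pairCorr_le (ω : InfVolFermionState 2) (S : Finset (Site 2)) (g : Site 2 → ℝ)
    (x y : Site 2) : ‖ω.pairCorr S g x y‖ ≤ (2 * ∑ e ∈ S, |g e / Real.sqrt 2|) ^ 2 := by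
  have hK := two_mul_sum_abs_div_sqrt_two_nonneg S g
  rw [InfVolFermionState.pairCorr]
  refine (ω.norm_corr_le _ _).trans ?_
  rw [l2_opNorm_conjTranspose, sq]
  exact mul_le_mul (norm_localPairAt_le S g x) (norm_localPairAt_le S g y) (norm_nonneg _) hK

/-- `|Re ω(P_x⋆ P_y)| ≤ K²`. [cite: Sewell1970, §4] -/
theorem InfVolFermionState.abs_re_pairCorr_le (ω : InfVolFermionState 2) (S : Finset (Site 2))
    (g : Site 2 → ℝ) (x y : Site 2) : |(ω.pairCorr S g x y).re| ≤ (2 * ∑ e ∈ S, |g e / Real.sqrt 2|) ^ 2 :=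
  (Complex.abs_re_le_norm _).trans (ω.norm_pairCorr_le S g x y)

/-- `|Re φ_L(P̃_x̄⋆ P̃_ȳ)| ≤ K²` for the box state (contractivity). [cite: BratteliRobinsonI1987, Prop. 2.3.11] -/
theorem InfVolFermionState.abs_re_boxState_localPairOn_conjTranspose_mul_le (ω : InfVolFermionState 2)
    (L : ℕ) [NeZero L] (S : Finset (Site 2)) (g : Site 2 → ℝ) (a b : TorusSite 2 L) :
    |(ω.boxState L ((localPairOn S g L a)ᴴ * localPairOn S g L b)).re| ≤ (2 * ∑ e ∈ S, |g e / Real.sqrt 2|) ^ 2 := by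
  have hK := two_mul_sum_abs_div_sqrt_two_nonneg S g
  refine (ω.abs_re_boxState_le L _).trans ((norm_mul_le _ _).trans ?_)
  rw [l2_opNorm_conjTranspose, sq]
  exact mul_le_mul (norm_localPairOn_le S g L a) (norm_localPairOn_le S g L b) (norm_nonneg _) hK

end Norms

/-! ### §2 Interior pairs: the box state sees the infinite-volume two-point function -/

section Interior

variable (L : ℕ) [NeZero L] (ω : InfVolFermionState 2)

/-- The pair region of `x` is the translate of the pair region of the origin. [cite: Scalapino1995, §2] -/
theorem pairRegion_eq_shiftSet (S : Finset (Site 2)) (x : Site 2) : pairRegion S x = shiftSet x (pairRegion S 0) := by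
  rw [shiftSet_pairRegion, zero_add]

/-- **INTERIOR PAIRS**: if the pair regions of `x, y ∈ ℤ²` lie inside the box `[0,L)²`, the box state of the
torus word `P̃_{x mod L}⋆ P̃_{y mod L}` is the infinite-volume two-point function `ω(P_x⋆ P_y)`
(`Γ(ι) P_x = P̃_{x mod L}`, both factors pulled back through the box, defining property of `φ_L`).
[cite: BratteliRobinsonII1997, §6.2.2] -/
theorem InfVolFermionState.boxState_localPairOn_conjTranspose_mul_localPairOn (S : Finset (Site 2))
    (g : Site 2 → ℝ) {x y : Site 2} (hx : pairRegion S x ⊆ halfOpenBox 2 L) (hy : pairRegion S y ⊆ halfOpenBox 2 L) :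
    ω.boxState L ((localPairOn S g L (Torus.proj L x))ᴴ * localPairOn S g L (Torus.proj L y)) = ω.pairCorr S g x y := by
  have hxI : Set.InjOn (Torus.proj (d := 2) L) ↑(pairRegion S x) :=
    (injOn_proj_halfOpenBox (d := 2) L).mono (by exact_mod_cast hx)
  have hyI : Set.InjOn (Torus.proj (d := 2) L) ↑(pairRegion S y) :=
    (injOn_proj_halfOpenBox (d := 2) L).mono (by exact_mod_cast hy)
  have ex : localPairOn S g L (Torus.proj L x) =
      fermionEmbed (PolySite.toTorusEmb L (injOn_proj_halfOpenBox (d := 2) L))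
        (fermionEmbed (PolySite.incl hx) (localPairAt S g x)) := by
    rw [← fermionEmbed_toTorusEmb_localPairAt L S g x hxI, fermionEmbed_fermionEmbed]
    exact congrFun (congrArg DFunLike.coe (fermionEmbed_congr fun p => rfl)) _
  have ey : localPairOn S g L (Torus.proj L y) =
      fermionEmbed (PolySite.toTorusEmb L (injOn_proj_halfOpenBox (d := 2) L))
        (fermionEmbed (PolySite.incl hy) (localPairAt S g y)) := by
    rw [← fermionEmbed_toTorusEmb_localPairAt L S g y hyI, fermionEmbed_fermionEmbed]
    exact congrFun (congrArg DFunLike.coe (fermionEmbed_congr fun p => rfl)) _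
  rw [ex, ey, ← fermionEmbed_conjTranspose, ← fermionEmbed_mul,
    ω.boxState_fermionEmbed_toTorusEmb L (Finset.Subset.refl _) (injOn_proj_halfOpenBox (d := 2) L),
    InfVolFermionState.pairCorr, ω.corr_eq_expect_of_subset hx hy, fermionEmbed_conjTranspose]

end Interior

/-! ### §3 The two-point bookkeeping: `φ_L(Δ̃⋆Δ̃)` versus the box pair-LRO sum -/

section Bookkeeping

variable (L : ℕ) [NeZero L]

/-- The torus pair field as a box sum: `Δ̃ = Σ_{x ∈ [0,L)²} P̃_{x mod L}`. [cite: Scalapino1995, §2] -/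
theorem pairFieldOn_eq_sum_halfOpenBox (S : Finset (Site 2)) (g : Site 2 → ℝ) :
    pairFieldOn S g L = ∑ x ∈ halfOpenBox 2 L, localPairOn S g L (Torus.proj L x) := by
  rw [pairFieldOn, InfVolFermionState.sum_univ_torus_eq_sum_halfOpenBox]

/-- `φ_L(Δ̃⋆Δ̃) = Σ_{x,y ∈ [0,L)²} φ_L(P̃_{x mod L}⋆ P̃_{y mod L})`. [cite: Scalapino1995, §2] -/
theorem InfVolFermionState.boxState_pairFieldOn_conjTranspose_mul (ω : InfVolFermionState 2)
    (S : Finset (Site 2)) (g : Site 2 → ℝ) :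
    ω.boxState L ((pairFieldOn S g L)ᴴ * pairFieldOn S g L) =
      ∑ x ∈ halfOpenBox 2 L, ∑ y ∈ halfOpenBox 2 L,
        ω.boxState L ((localPairOn S g L (Torus.proj L x))ᴴ * localPairOn S g L (Torus.proj L y)) := by
  rw [pairFieldOn_eq_sum_halfOpenBox, Matrix.conjTranspose_sum, Finset.sum_mul, map_sum]
  refine Finset.sum_congr rfl fun x _ => ?_
  rw [Finset.mul_sum, map_sum]

/-- **THE TWO-POINT BOOKKEEPING** (every state, every step set `S` with `{0} ∪ S ⊆ [−R,R]²`, `2R ≤ L`):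
`|Re φ_L(Δ̃⋆Δ̃) − Re Σ_{x,y ∈ [0,L)²} ω(P_x⋆P_y)| ≤ 4K²·(L² − (L−2R)²)·L²`, `K = 2Σ_{e∈S}|g e/√2|`:
interior pairs agree (§2), at most `2·(L² − (L−2R)²)·L²` pairs have a wrapped end, and each of those
differs by at most `2K²`. [cite: BratteliRobinsonII1997, §6.2.2] -/
theorem InfVolFermionState.abs_re_boxState_pairFieldOn_sub_re_sum_pairCorr_le (ω : InfVolFermionState 2)
    (S : Finset (Site 2)) (g : Site 2 → ℝ) {R : ℕ} (hR : ∀ z ∈ pairRegion S 0, ∀ i, |z i| ≤ R) (h2R : 2 * R ≤ L) :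
    |(ω.boxState L ((pairFieldOn S g L)ᴴ * pairFieldOn S g L)).re -
        (∑ x ∈ halfOpenBox 2 L, ∑ y ∈ halfOpenBox 2 L, ω.pairCorr S g x y).re| ≤
      4 * (2 * ∑ e ∈ S, |g e / Real.sqrt 2|) ^ 2 * ((L : ℝ) ^ 2 - ((L - 2 * R : ℕ) : ℝ) ^ 2) * (L : ℝ) ^ 2 := by
  classical
  set K : ℝ := 2 * ∑ e ∈ S, |g e / Real.sqrt 2| with hK
  set B := halfOpenBox 2 L with hB
  set J := B.filter fun x => ¬ shiftSet x (pairRegion S 0) ⊆ B with hJ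
  set D : Site 2 → Site 2 → ℝ := fun x y =>
    (ω.boxState L ((localPairOn S g L (Torus.proj L x))ᴴ * localPairOn S g L (Torus.proj L y))).re -
      (ω.pairCorr S g x y).re with hD
  have hK2 : 0 ≤ K ^ 2 := sq_nonneg K
  -- the difference as a double sum
  have hdiff : (ω.boxState L ((pairFieldOn S g L)ᴴ * pairFieldOn S g L)).re -
      (∑ x ∈ B, ∑ y ∈ B, ω.pairCorr S g x y).re = ∑ x ∈ B, ∑ y ∈ B, D x y := by
    rw [ω.boxState_pairFieldOn_conjTranspose_mul L S g, Complex.re_sum, Complex.re_sum, ← Finset.sum_sub_distrib]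
    refine Finset.sum_congr rfl fun x _ => ?_
    rw [Complex.re_sum, Complex.re_sum, ← Finset.sum_sub_distrib]
  -- interior pairs agree
  have hint : ∀ x ∈ B, x ∉ J → pairRegion S x ⊆ B := by
    intro x hx hxJ
    rw [hJ, Finset.mem_filter, not_and, not_not] at hxJ
    rw [pairRegion_eq_shiftSet]
    exact hxJ hx
  have hD0 : ∀ x y, pairRegion S x ⊆ B → pairRegion S y ⊆ B → D x y = 0 := by
    intro x y hx hy
    simp only [hD]
    rw [ω.boxState_localPairOn_conjTranspose_mul_localPairOn L S g hx hy, sub_self]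
  -- every pair differs by at most `2K²`
  have hDle : ∀ x y, |D x y| ≤ 2 * K ^ 2 := by
    intro x y
    simp only [hD]
    have h1 := ω.abs_re_boxState_localPairOn_conjTranspose_mul_le L S g (Torus.proj L x) (Torus.proj L y)
    have h2 := ω.abs_re_pairCorr_le S g x y
    rw [← hK] at h1 h2
    have := abs_sub _ _ |>.trans (add_le_add h1 h2)
    linarith
  -- pointwise: `|D x y| ≤ 2K² (𝟙_J x + 𝟙_J y)` on the box
  have hpt : ∀ x ∈ B, ∀ y ∈ B,
      |D x y| ≤ 2 * K ^ 2 * ((if x ∈ J then 1 else 0) + (if y ∈ J then 1 else 0)) := by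
    intro x hx y hy
    by_cases hxJ : x ∈ J
    · rw [if_pos hxJ]
      have : (0 : ℝ) ≤ if y ∈ J then 1 else 0 := by split_ifs <;> norm_num
      nlinarith [hDle x y]
    · by_cases hyJ : y ∈ J
      · rw [if_neg hxJ, if_pos hyJ]
        linarith [hDle x y]
      · rw [if_neg hxJ, if_neg hyJ, hD0 x y (hint x hx hxJ) (hint y hy hyJ), abs_zero]
        norm_num
  -- count
  have hJB : J ⊆ B := Finset.filter_subset _ _
  have hcardB : (B.card : ℝ) = (L : ℝ) ^ 2 := by rw [hB, card_halfOpenBox]; push_cast; ring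
  have hJcard : (J.card : ℝ) ≤ (L : ℝ) ^ 2 - ((L - 2 * R : ℕ) : ℝ) ^ 2 :=
    card_filter_not_shiftSet_subset_halfOpenBox_le (d := 2) hR h2R
  have hind : ∑ x ∈ B, (if x ∈ J then (1 : ℝ) else 0) = J.card := by
    rw [Finset.sum_boole, Finset.filter_mem_eq_inter, Finset.inter_eq_right.2 hJB]
  have hsum : ∑ x ∈ B, ∑ y ∈ B, 2 * K ^ 2 * ((if x ∈ J then (1 : ℝ) else 0) + (if y ∈ J then 1 else 0)) =
      2 * K ^ 2 * (2 * (J.card : ℝ) * (L : ℝ) ^ 2) := by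
    have h1 : ∀ x ∈ B, ∑ y ∈ B, 2 * K ^ 2 * ((if x ∈ J then (1 : ℝ) else 0) + (if y ∈ J then 1 else 0)) =
        2 * K ^ 2 * ((B.card : ℝ) * (if x ∈ J then (1 : ℝ) else 0) + J.card) := by
      intro x _
      rw [← Finset.mul_sum, Finset.sum_add_distrib, Finset.sum_const, nsmul_eq_mul, hind]
    rw [Finset.sum_congr rfl h1, ← Finset.mul_sum, Finset.sum_add_distrib, ← Finset.mul_sum, hind,
      Finset.sum_const, nsmul_eq_mul, hcardB]
    ring
  rw [hdiff]
  calc |∑ x ∈ B, ∑ y ∈ B, D x y| ≤ ∑ x ∈ B, |∑ y ∈ B, D x y| := Finset.abs_sum_le_sum_abs _ _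
    _ ≤ ∑ x ∈ B, ∑ y ∈ B, |D x y| := Finset.sum_le_sum fun x _ => Finset.abs_sum_le_sum_abs _ _
    _ ≤ ∑ x ∈ B, ∑ y ∈ B, 2 * K ^ 2 * ((if x ∈ J then (1 : ℝ) else 0) + (if y ∈ J then 1 else 0)) :=
        Finset.sum_le_sum fun x hx => Finset.sum_le_sum fun y hy => hpt x hx y hy
    _ = 2 * K ^ 2 * (2 * (J.card : ℝ) * (L : ℝ) ^ 2) := hsum
    _ ≤ 2 * K ^ 2 * (2 * ((L : ℝ) ^ 2 - ((L - 2 * R : ℕ) : ℝ) ^ 2) * (L : ℝ) ^ 2) := by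
        refine mul_le_mul_of_nonneg_left ?_ (by positivity)
        exact mul_le_mul_of_nonneg_right (by linarith) (by positivity)
    _ = 4 * K ^ 2 * ((L : ℝ) ^ 2 - ((L - 2 * R : ℕ) : ℝ) ^ 2) * (L : ℝ) ^ 2 := by ring

/-- The unit steps lie in `[−1,1]²`. [cite: Scalapino1995, §2] -/
private theorem abs_apply_le_one_of_mem_unitSteps {e : Site 2} (he : e ∈ unitSteps) (i : Fin 2) : |e i| ≤ 1 := by
  simp only [unitSteps, Finset.mem_insert, Finset.mem_singleton] at he
  rcases he with rfl | rfl | rfl | rfl <;> fin_cases i <;> simp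

/-- The `d`-wave pair region of the origin `{0, ±e₁, ±e₂}` lies in `[−1,1]²`. [cite: Scalapino1995, §2] -/
private theorem abs_apply_le_one_of_mem_pairRegion_zero {z : Site 2}
    (hz : z ∈ pairRegion (insert (0 : Site 2) unitSteps) 0) (i : Fin 2) : |z i| ≤ (1 : ℕ) := by
  simp only [pairRegion, Finset.mem_insert, Finset.mem_image, zero_add] at hz
  rcases hz with rfl | ⟨e, he, rfl⟩
  · simp
  · rcases he with rfl | he
    · simp
    · exact_mod_cast abs_apply_le_one_of_mem_unitSteps he i

/-- The planar count `L² − (L − 2)² ≤ 4L` (`2 ≤ L`). [cite: BratteliRobinsonII1997, §6.2.2] -/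
private theorem sq_sub_sq_le_four_mul {L : ℕ} (hL : 2 ≤ L) : (L : ℝ) ^ 2 - ((L - 2 * 1 : ℕ) : ℝ) ^ 2 ≤ 4 * L := by
  rw [mul_one, Nat.cast_sub hL, Nat.cast_two]
  nlinarith

/-- **The `d`-wave-type pair field** (`S = {0} ∪ unitSteps`, any form factor `g`, `L ≥ 2`):
`|Re φ_L(Δ_g⋆Δ_g) − Re Σ_{x,y∈[0,L)²} ω(P_x⋆P_y)| ≤ 16K_g²·L³`. [cite: BratteliRobinsonII1997, §6.2.2] -/
theorem InfVolFermionState.abs_re_boxState_pairField_sub_re_sum_pairCorr_le (ω : InfVolFermionState 2)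
    (g : Site 2 → ℝ) (hL : 2 ≤ L) :
    |(ω.boxState L ((pairField g L)ᴴ * pairField g L)).re -
        (∑ x ∈ halfOpenBox 2 L, ∑ y ∈ halfOpenBox 2 L, ω.pairCorr (insert 0 unitSteps) g x y).re| ≤
      16 * (2 * ∑ e ∈ insert (0 : Site 2) unitSteps, |g e / Real.sqrt 2|) ^ 2 * (L : ℝ) ^ 3 := by
  have h := ω.abs_re_boxState_pairFieldOn_sub_re_sum_pairCorr_le L (insert 0 unitSteps) g
    (R := 1) (fun z hz i => abs_apply_le_one_of_mem_pairRegion_zero hz i) (by omega)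
  rw [pairFieldOn_insert_zero_unitSteps] at h
  refine h.trans ?_
  have h4 := sq_sub_sq_le_four_mul hL
  have hK2 : 0 ≤ (2 * ∑ e ∈ insert (0 : Site 2) unitSteps, |g e / Real.sqrt 2|) ^ 2 := sq_nonneg _
  have hL0 : (0 : ℝ) ≤ L := Nat.cast_nonneg L
  calc 4 * (2 * ∑ e ∈ insert (0 : Site 2) unitSteps, |g e / Real.sqrt 2|) ^ 2 *
        ((L : ℝ) ^ 2 - ((L - 2 * 1 : ℕ) : ℝ) ^ 2) * (L : ℝ) ^ 2
      ≤ 4 * (2 * ∑ e ∈ insert (0 : Site 2) unitSteps, |g e / Real.sqrt 2|) ^ 2 * (4 * L) * (L : ℝ) ^ 2 := by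
        refine mul_le_mul_of_nonneg_right (mul_le_mul_of_nonneg_left h4 (by positivity)) (by positivity)
    _ = 16 * (2 * ∑ e ∈ insert (0 : Site 2) unitSteps, |g e / Real.sqrt 2|) ^ 2 * (L : ℝ) ^ 3 := by ring

/-- **The `d`-wave pair field in the cell's box normal form** (`L ≥ 2`, every state `ω`):
`|L⁻⁴ Re φ_L(Δ_d⋆Δ_d) − Re L⁻⁴ Σ_{x,y∈[0,L)²} ω(P_x^d⋆P_y^d)| ≤ 16K_d²/L`, `K_d = 2Σ_e |d(e)/√2|`.
[cite: BratteliRobinsonII1997, §6.2.2] -/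
theorem InfVolFermionState.abs_re_boxState_pairField_div_sub_re_boxAverage_dWavePairCorr_le
    (ω : InfVolFermionState 2) (hL : 2 ≤ L) :
    |((L : ℝ) ^ 4)⁻¹ * (ω.boxState L ((pairField dWaveFormFactor L)ᴴ * pairField dWaveFormFactor L)).re -
        (((L : ℂ) ^ 4)⁻¹ * ∑ x ∈ halfOpenBox 2 L, ∑ y ∈ halfOpenBox 2 L, ω.dWavePairCorr x y).re| ≤
      16 * (2 * ∑ e ∈ insert (0 : Site 2) unitSteps, |dWaveFormFactor e / Real.sqrt 2|) ^ 2 / L := by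
  have hL0 : (0 : ℝ) < L := by exact_mod_cast (show 0 < L by omega)
  have hL4 : (0 : ℝ) < (L : ℝ) ^ 4 := by positivity
  have h := ω.abs_re_boxState_pairField_sub_re_sum_pairCorr_le L dWaveFormFactor hL
  have hre : (((L : ℂ) ^ 4)⁻¹ * ∑ x ∈ halfOpenBox 2 L, ∑ y ∈ halfOpenBox 2 L, ω.dWavePairCorr x y).re =
      ((L : ℝ) ^ 4)⁻¹ * (∑ x ∈ halfOpenBox 2 L, ∑ y ∈ halfOpenBox 2 L,
        ω.pairCorr (insert 0 unitSteps) dWaveFormFactor x y).re := by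
    have hc : ((L : ℂ) ^ 4)⁻¹ = ((((L : ℝ) ^ 4)⁻¹ : ℝ) : ℂ) := by push_cast; ring
    rw [hc, Complex.re_ofReal_mul]
    rfl
  rw [hre, ← mul_sub, abs_mul, abs_of_pos (inv_pos.2 hL4)]
  calc ((L : ℝ) ^ 4)⁻¹ * |(ω.boxState L ((pairField dWaveFormFactor L)ᴴ * pairField dWaveFormFactor L)).re -
        (∑ x ∈ halfOpenBox 2 L, ∑ y ∈ halfOpenBox 2 L, ω.pairCorr (insert 0 unitSteps) dWaveFormFactor x y).re|
      ≤ ((L : ℝ) ^ 4)⁻¹ * (16 * (2 * ∑ e ∈ insert (0 : Site 2) unitSteps, |dWaveFormFactor e / Real.sqrt 2|) ^ 2 *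
          (L : ℝ) ^ 3) := mul_le_mul_of_nonneg_left h (inv_pos.2 hL4).le
    _ = 16 * (2 * ∑ e ∈ insert (0 : Site 2) unitSteps, |dWaveFormFactor e / Real.sqrt 2|) ^ 2 / L := by
        field_simp

end Bookkeeping

/-! ### §4 The sourced `t–t'` torus under the box state of a translation-invariant (ground) state -/

section Sourced

variable {L : ℕ} [NeZero L]

/-- The sourced window `[−1,1]² ∪ {0, ±e₁, ±e₂}` lies in `[−1,1]²`. [cite: KomaTasaki1994, §1] -/
private theorem abs_apply_le_one_of_mem_dWaveSourceWindow {z : Site 2} (hz : z ∈ dWaveSourceWindow)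
    (i : Fin 2) : |z i| ≤ (1 : ℕ) := by
  rw [dWaveSourceWindow, Finset.mem_union] at hz
  rcases hz with hz | hz
  · simp only [thicken, Finset.mem_biUnion, Finset.mem_singleton, Finset.mem_image] at hz
    obtain ⟨y, rfl, v, hv, rfl⟩ := hz
    rw [Nat.floor_one, mem_box] at hv
    have h := hv i
    rw [zero_add, Nat.cast_one, abs_le]
    exact_mod_cast h
  · exact abs_apply_le_one_of_mem_pairRegion_zero hz i

/-- **THE SOURCED TORUS UNDER THE BOX STATE** (translation-invariant `ω`, `L ≥ 3`, the window fitting the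
torus): `|Re φ_L(A_L(t',U,μ,h)) − L²·e_{Ψ_h}(ω)| ≤ 4L·C_src`, `C_src = −E₀(−E^src) − E₀(E^src)`: the interior
translates of the sourced energy-density observable contribute the mean energy `e_{Ψ_h}(ω) = Re ω(E^src)`
each (`re_expect_dWaveSourceEnergyObsTT'_eq_meanEnergy`), the `≤ 4L` wrapped ones are bounded by positivity.
[cite: BratteliRobinsonII1997, §6.2.2] -/
theorem InfVolFermionState.abs_re_boxState_dWaveSourceTorusTT'_sub_sq_mul_meanEnergy_le (hL : 3 ≤ L)
    (hInj : Set.InjOn (Torus.proj (d := 2) L) ↑dWaveSourceWindow) (t' U μ h : ℝ) {ω : InfVolFermionState 2}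
    (hω : ω.IsTranslationInvariant) :
    |(ω.boxState L (dWaveSourceTorusTT' L t' U μ h)).re -
        (L : ℝ) ^ 2 * ω.meanEnergy (hubbardTTPrimeSourcedInteraction 1 t' U μ dWaveFormFactor h) 1| ≤
      4 * L * (-(-dWaveSourceEnergyObsTT' t' U μ h).groundEnergy - (dWaveSourceEnergyObsTT' t' U μ h).groundEnergy) := by
  have hE := dWaveSourceEnergyObsTT'_isHermitian t' U μ h
  have hbd := ω.abs_re_boxState_sub_pow_mul_re_expect_le L hω hInj hE (R := 1)
    (fun z hz i => abs_apply_le_one_of_mem_dWaveSourceWindow hz i) (by omega)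
    (sum_relabel_translate_dWaveSourceEnergyObsTT' hL hInj t' U μ h)
  rw [ω.re_expect_dWaveSourceEnergyObsTT'_eq_meanEnergy] at hbd
  refine hbd.trans ?_
  have hC : 0 ≤ -(-dWaveSourceEnergyObsTT' t' U μ h).groundEnergy - (dWaveSourceEnergyObsTT' t' U μ h).groundEnergy := by
    have h1 := ω.groundEnergy_le_re_expect _ hE
    have h2 := ω.re_expect_le_neg_groundEnergy_neg _ hE
    linarith
  exact mul_le_mul_of_nonneg_right (sq_sub_sq_le_four_mul (by omega)) hC

/-- For a translation-invariant GROUND STATE of `Ψ_h` the reference value is the torus-limit energy density: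
`|Re φ_L(A_L(h)) − L²·E(h)| ≤ 4L·C_src`, `E = dWaveSourceEnergyDensityTT' t' U μ`.
[cite: BratteliKishimotoRobinson1978, Thm. 2] -/
theorem InfVolFermionState.IsMeanEnergyMinimiser.abs_re_boxState_dWaveSourceTorusTT'_sub_le (hL : 3 ≤ L)
    (hInj : Set.InjOn (Torus.proj (d := 2) L) ↑dWaveSourceWindow) {t' U μ h : ℝ} {ω : InfVolFermionState 2}
    (hω : ω.IsMeanEnergyMinimiser (hubbardTTPrimeSourcedInteraction 1 t' U μ dWaveFormFactor h) 1) :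
    |(ω.boxState L (dWaveSourceTorusTT' L t' U μ h)).re - (L : ℝ) ^ 2 * dWaveSourceEnergyDensityTT' t' U μ h| ≤
      4 * L * (-(-dWaveSourceEnergyObsTT' t' U μ h).groundEnergy - (dWaveSourceEnergyObsTT' t' U μ h).groundEnergy) := by
  have hbd := InfVolFermionState.abs_re_boxState_dWaveSourceTorusTT'_sub_sq_mul_meanEnergy_le hL hInj t' U μ h hω.1
  rwa [hω.meanEnergy_eq, tiGroundEnergyDensity_dWaveSourced_eq] at hbd

/-- **THE TRIAL-STATE INEQUALITY FOR THE APPROXIMATING-HAMILTONIAN CHAIN** (step (ε) assembled): for a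
translation-invariant ground state `ω` of `Ψ_h`, `L ≥ 3` with the window fitting the torus, and `c ≥ 0`,
`E₀(A_L(h) − c•Δ_d⋆Δ_d) ≤ L²·E(h) + 4C_src·L − c·(L⁴·boxLRO_L(ω) − 16K_d²·L³)`,
`boxLRO_L(ω) = Re L⁻⁴ Σ_{x,y∈[0,L)²} ω(P_x^d⋆ P_y^d)`: the box state of `ω` is the trial state, its energy is
`L²E(h)` up to `4L` wrapped bonds, and its pair-field fluctuation is the box pair-LRO sum up to `O(L³)` wrapped
pairs. [cite: Bogolubov1966, Theorem 1] -/
theorem InfVolFermionState.IsMeanEnergyMinimiser.groundEnergy_dWaveSourceTorusTT'_sub_smul_le (hL : 3 ≤ L)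
    (hInj : Set.InjOn (Torus.proj (d := 2) L) ↑dWaveSourceWindow) {t' U μ h : ℝ} {ω : InfVolFermionState 2}
    (hω : ω.IsMeanEnergyMinimiser (hubbardTTPrimeSourcedInteraction 1 t' U μ dWaveFormFactor h) 1)
    {c : ℝ} (hc : 0 ≤ c) :
    (dWaveSourceTorusTT' L t' U μ h - (c : ℂ) • ((pairField dWaveFormFactor L)ᴴ * pairField dWaveFormFactor L)).groundEnergy ≤
      (L : ℝ) ^ 2 * dWaveSourceEnergyDensityTT' t' U μ h +
        4 * L * (-(-dWaveSourceEnergyObsTT' t' U μ h).groundEnergy - (dWaveSourceEnergyObsTT' t' U μ h).groundEnergy) -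
        c * ((L : ℝ) ^ 4 * (((L : ℂ) ^ 4)⁻¹ * ∑ x ∈ halfOpenBox 2 L, ∑ y ∈ halfOpenBox 2 L, ω.dWavePairCorr x y).re -
          16 * (2 * ∑ e ∈ insert (0 : Site 2) unitSteps, |dWaveFormFactor e / Real.sqrt 2|) ^ 2 * (L : ℝ) ^ 3) := by
  have hL2 : 2 ≤ L := by omega
  have hL0 : (0 : ℝ) < L := by exact_mod_cast (show 0 < L by omega)
  have hL4 : (0 : ℝ) < (L : ℝ) ^ 4 := by positivity
  -- variational principle with the box state
  have h0 := ω.groundEnergy_sub_smul_conjTranspose_mul_le_re_boxState L (dWaveSourceTorusTT'_isHermitian L t' U μ h)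
    (pairField dWaveFormFactor L) c
  -- the energy of the trial state
  have h1 := abs_le.1 (hω.abs_re_boxState_dWaveSourceTorusTT'_sub_le hL hInj)
  -- its pair-field fluctuation
  have h2 := abs_le.1 (ω.abs_re_boxState_pairField_div_sub_re_boxAverage_dWavePairCorr_le L hL2)
  have h2' : (L : ℝ) ^ 4 * (((L : ℂ) ^ 4)⁻¹ * ∑ x ∈ halfOpenBox 2 L, ∑ y ∈ halfOpenBox 2 L, ω.dWavePairCorr x y).re -
      16 * (2 * ∑ e ∈ insert (0 : Site 2) unitSteps, |dWaveFormFactor e / Real.sqrt 2|) ^ 2 * (L : ℝ) ^ 3 ≤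
      (ω.boxState L ((pairField dWaveFormFactor L)ᴴ * pairField dWaveFormFactor L)).re := by
    have h3 : (((L : ℂ) ^ 4)⁻¹ * ∑ x ∈ halfOpenBox 2 L, ∑ y ∈ halfOpenBox 2 L, ω.dWavePairCorr x y).re -
        16 * (2 * ∑ e ∈ insert (0 : Site 2) unitSteps, |dWaveFormFactor e / Real.sqrt 2|) ^ 2 / L ≤
        ((L : ℝ) ^ 4)⁻¹ * (ω.boxState L ((pairField dWaveFormFactor L)ᴴ * pairField dWaveFormFactor L)).re := by
      linarith [h2.1]
    have h4 := mul_le_mul_of_nonneg_left h3 hL4.le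
    have hne : (L : ℝ) ≠ 0 := hL0.ne'
    rw [mul_sub, ← mul_assoc, mul_inv_cancel₀ hL4.ne', one_mul] at h4
    have h5 : (L : ℝ) ^ 4 * (16 * (2 * ∑ e ∈ insert (0 : Site 2) unitSteps, |dWaveFormFactor e / Real.sqrt 2|) ^ 2 / L) =
        16 * (2 * ∑ e ∈ insert (0 : Site 2) unitSteps, |dWaveFormFactor e / Real.sqrt 2|) ^ 2 * (L : ℝ) ^ 3 := by
      field_simp
    rw [h5] at h4
    exact h4
  have h6 := mul_le_mul_of_nonneg_left h2' hc
  linarith [h1.2]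

end Sourced

/-! ### §5 The trial-state inequality in the linear `(c₁, c₂, L₁)` shape consumed by the `(ζ)` assembler -/

section Linear

/-- **THE TRIAL-STATE INEQUALITY, linear shape** (the interface requested by the `(ζ)`/`(η)` assembler of
`TIGroundStatePairLROCeiling`, hubbard-cq-p3): for every translation-invariant ground state `ω` of `Ψ_h` there are
constants `c₁, c₂` and a side `L₁` such that for all `L ≥ L₁` and all couplings `g ≥ 0`,
`E₀(A_L(h) − (g/L²)•Δ_d⋆Δ_d) ≤ L²·E(h) + c₁·L − g·L²·boxLRO_L(ω) + g·c₂·L`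
(`c₁ = 4C_src`, `c₂ = 16K_d²`, `L₁` = the first side from which the sourced window fits the torus, at least `3`).
[cite: Bogolubov1966, Theorem 1] -/
theorem InfVolFermionState.IsMeanEnergyMinimiser.exists_groundEnergy_dWaveSourceTorusTT'_sub_smul_le_linear
    {t' U μ h : ℝ} {ω : InfVolFermionState 2}
    (hω : ω.IsMeanEnergyMinimiser (hubbardTTPrimeSourcedInteraction 1 t' U μ dWaveFormFactor h) 1) :
    ∃ c₁ c₂ : ℝ, ∃ L₁ : ℕ, ∀ (L : ℕ) [NeZero L], L₁ ≤ L → ∀ g : ℝ, 0 ≤ g →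
      (dWaveSourceTorusTT' L t' U μ h -
          ((g / (L : ℝ) ^ 2 : ℝ) : ℂ) • ((pairField dWaveFormFactor L)ᴴ * pairField dWaveFormFactor L)).groundEnergy ≤
        (L : ℝ) ^ 2 * dWaveSourceEnergyDensityTT' t' U μ h + c₁ * L -
          g * (L : ℝ) ^ 2 *
            (((L : ℂ) ^ 4)⁻¹ * ∑ x ∈ halfOpenBox 2 L, ∑ y ∈ halfOpenBox 2 L, ω.dWavePairCorr x y).re +
          g * c₂ * L := by
  obtain ⟨L₀, hL₀⟩ := exists_forall_le_injOn_proj (d := 2) dWaveSourceWindow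
  refine ⟨4 * (-(-dWaveSourceEnergyObsTT' t' U μ h).groundEnergy - (dWaveSourceEnergyObsTT' t' U μ h).groundEnergy),
    16 * (2 * ∑ e ∈ insert (0 : Site 2) unitSteps, |dWaveFormFactor e / Real.sqrt 2|) ^ 2, max L₀ 3,
    fun L _ hL g hg => ?_⟩
  have hL3 : 3 ≤ L := le_trans (le_max_right _ _) hL
  have hInj := hL₀ L (le_trans (le_max_left _ _) hL)
  have hL0 : (0 : ℝ) < L := by exact_mod_cast (show 0 < L by omega)
  have hc : 0 ≤ g / (L : ℝ) ^ 2 := div_nonneg hg (by positivity)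
  have hmain := hω.groundEnergy_dWaveSourceTorusTT'_sub_smul_le hL3 hInj hc
  set X : ℝ := (((L : ℂ) ^ 4)⁻¹ * ∑ x ∈ halfOpenBox 2 L, ∑ y ∈ halfOpenBox 2 L, ω.dWavePairCorr x y).re with hX
  set K2 : ℝ := 16 * (2 * ∑ e ∈ insert (0 : Site 2) unitSteps, |dWaveFormFactor e / Real.sqrt 2|) ^ 2 with hK2
  have halg : g / (L : ℝ) ^ 2 * ((L : ℝ) ^ 4 * X - K2 * (L : ℝ) ^ 3) = g * (L : ℝ) ^ 2 * X - g * K2 * L := by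
    field_simp
  rw [halg] at hmain
  linarith

/-- The same with the constant `c₂` and the side `L₁` UNIFORM in the field `h` and the state `ω` (only
`c₁ = 4C_src(h)` depends on `h`). [cite: Bogolubov1966, Theorem 1] -/
theorem exists_forall_isMeanEnergyMinimiser_groundEnergy_dWaveSourceTorusTT'_sub_smul_le_linear (t' U μ : ℝ) :
    ∃ c₂ : ℝ, ∃ L₁ : ℕ, ∀ h : ℝ, ∃ c₁ : ℝ, ∀ ⦃ω : InfVolFermionState 2⦄,
      ω.IsMeanEnergyMinimiser (hubbardTTPrimeSourcedInteraction 1 t' U μ dWaveFormFactor h) 1 →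
      ∀ (L : ℕ) [NeZero L], L₁ ≤ L → ∀ g : ℝ, 0 ≤ g →
        (dWaveSourceTorusTT' L t' U μ h -
            ((g / (L : ℝ) ^ 2 : ℝ) : ℂ) • ((pairField dWaveFormFactor L)ᴴ * pairField dWaveFormFactor L)).groundEnergy ≤
          (L : ℝ) ^ 2 * dWaveSourceEnergyDensityTT' t' U μ h + c₁ * L -
            g * (L : ℝ) ^ 2 *
              (((L : ℂ) ^ 4)⁻¹ * ∑ x ∈ halfOpenBox 2 L, ∑ y ∈ halfOpenBox 2 L, ω.dWavePairCorr x y).re +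
            g * c₂ * L := by
  obtain ⟨L₀, hL₀⟩ := exists_forall_le_injOn_proj (d := 2) dWaveSourceWindow
  refine ⟨16 * (2 * ∑ e ∈ insert (0 : Site 2) unitSteps, |dWaveFormFactor e / Real.sqrt 2|) ^ 2, max L₀ 3,
    fun h => ⟨4 * (-(-dWaveSourceEnergyObsTT' t' U μ h).groundEnergy - (dWaveSourceEnergyObsTT' t' U μ h).groundEnergy),
      fun ω hω L _ hL g hg => ?_⟩⟩
  have hL3 : 3 ≤ L := le_trans (le_max_right _ _) hL
  have hInj := hL₀ L (le_trans (le_max_left _ _) hL)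
  have hL0 : (0 : ℝ) < L := by exact_mod_cast (show 0 < L by omega)
  have hc : 0 ≤ g / (L : ℝ) ^ 2 := div_nonneg hg (by positivity)
  have hmain := hω.groundEnergy_dWaveSourceTorusTT'_sub_smul_le hL3 hInj hc
  set X : ℝ := (((L : ℂ) ^ 4)⁻¹ * ∑ x ∈ halfOpenBox 2 L, ∑ y ∈ halfOpenBox 2 L, ω.dWavePairCorr x y).re with hX
  set K2 : ℝ := 16 * (2 * ∑ e ∈ insert (0 : Site 2) unitSteps, |dWaveFormFactor e / Real.sqrt 2|) ^ 2 with hK2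
  have halg : g / (L : ℝ) ^ 2 * ((L : ℝ) ^ 4 * X - K2 * (L : ℝ) ^ 3) = g * (L : ℝ) ^ 2 * X - g * K2 * L := by
    field_simp
  rw [halg] at hmain
  linarith

end Linear

end Literature.MathematicalPhysics.QuantumLattice

end
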